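import Summits.BirchSwinnertonDyer.BirchSwinnertonDyer.Theorems.PrintCf2SplitBadTwoRestrictedSelmerLocalKummerLine
import Summits.BirchSwinnertonDyer.BirchSwinnertonDyer.Theorems.PrintCf2SplitBadTwoRestrictedSelmerBottomKummerEigen
import Summits.BirchSwinnertonDyer.BirchSwinnertonDyer.Theorems.PrintCf2SplitBadTwoRestrictedSelmerBottomValueOfFactors
import HarnessLib

/-!
# Crux `PrintCf2.SplitBadTwoRankOneOfFacts` (stmt-BirchSwinnertonDyer-20368), road α v10.3, S3c bottom value — (T-loc) / (T-loc-cl):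
# THE LOCAL KUMMER IMAGE AT A RANK-ONE PLACE HAS CYCLIC `p`-TORSION (`E(K_w) ⊗ ℚ_p/ℤ_p ≅ ℚ_p/ℤ_p` in cohomological currency), on every S3c frame

Cell `bsd-print-cf2`, width seat `bsd-line-cf2-p1-w7` g3; `--supports stmt-BirchSwinnertonDyer-20368` (helper, Theses-free). HONEST FRAMING: nothing here
closes a crux or a stub; BSD is not proved by any of this; no summit statement is proved by this seat. No definition, no named fact, no `sorry`, no kit.
beyond-print theorem: no.

WHAT. The two «local cyclicity» hypotheses displayed by the cell's S3c assembly — `hcyc` of -w3 g9's `comap_kummer_le_ker_resOfLe_of_finite_conj_of_cyclic`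
(p673070: `p`-torsion of `res_{D_v}(res_⊤ range κ)` cyclic) and `hcl` = (T-loc-cl) of LEAD g12's cut 13 `restrictedControl_two_of_ptFacts_factor_values`
(p674799: `2`-torsion of `res_{D_v}(localKerOver 2 ⊤ K_v)` cyclic) — from Silverman VII.6.3 at `[K_v : ℚ₂] = 1`:
* §1 algebra: `exists_eq_zsmul_of_zsmul_of_prime_smul_eq_zero` (in `ℤ•β`, `β` of `p`-power order, the `p`-torsion is cyclic),
  `exists_eq_zsmul_of_tower` (a subgroup exhausted by a `p`-divisible tower `β n = p^k β (n+k)` of such elements has cyclic `p`-torsion);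
* §2 at a place `w` with the rank-one relation through `P`: `map_resSubgroup_range_kummer_le_localKerOver`, **`kummer_local_cyclic_of_rankOne`** (`hcyc`),
  **`classical_local_cyclic_of_rankOne`** (`hcl`-shape) — every class is `M • res κ_n(P)` (`exists_resOfLe_eq_zsmul_kummer_of_rankOne`) and
  `κ_n(P) = p^k • κ_{n+k}(P)` (`kummerMapLevel_level`);
* §3 on the frame (`K` quadratic, `w ≠ w'` above `2`, any `V/K` with a `K`-point of infinite order): **`kummer_local_cyclic_of_frame`**,
  **`classical_local_cyclic_of_frame`** — at `w = v` AND at `w = v̄` (consumers: -w3 g9 (H1′), LEAD cut 13 `hcl`, -w6 g3 (F1) at `v̄`);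
* §4 **`bottom_exhaustion_at_vbar`** = the displayed hypothesis **(H2)** `hH2` of -w7 g2's `rBV_of_three_factor_values` (p665606) and of LEAD g12's cut 13,
  VERBATIM and unconditional: local half `exists_resOfLe_eq_zsmul_kummer_of_rankOne` at `v̄` + global half `zsmul_proj_resSubgroup_kummer_mem_comap_kummer`
  (p672215) + `e_* ι_* = id`;
* (the frame-verbatim `hcl` of LEAD g12's cut 13 is -w3 g9's `CMPrimes.hcl_holds` (`…LocalCyclicOfFrame`), landed while this file was in the
  farm queue; it is not restated here — `classical_local_cyclic_of_frame` is the per-curve form through any point of infinite order).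

References: A. Agboola, Compositio 143 (2007) §6 Prop. 6.11 (arXiv p0014) [Agboola2007]; R. Greenberg, LNM 1716 (1999) §2 Prop. 2.1 [GreenbergLNM1716];
J. H. Silverman, *AEC* 2nd ed., Prop. VII.6.3 [SilvermanAEC2009].
-/

noncomputable section

open scoped Classical TensorProduct

set_option linter.dupNamespace false -- `Summit.BirchSwinnertonDyer.BirchSwinnertonDyer` (summit = problem) is the tree's layout
set_option autoImplicit false

open NumberField IsDedekindDomain Field WeierstrassCurve
open Literature.NumberTheory.EllipticCurves Literature.NumberTheory.EllipticCurves.GreenbergSelmer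
open Literature.NumberTheory.EllipticCurves.Castella2018.AcSelmer
open Literature.NumberTheory.EllipticCurves.Agboola2007
open Literature.NumberTheory.EllipticCurves.ResKernel
open Literature.NumberTheory.GaloisRepresentations

universe u

namespace Summit.BirchSwinnertonDyer.BirchSwinnertonDyer.Theorems.PrintCf2.RestrictedSelmerPair

/-! ## §1. Algebra: the `p`-torsion inside the multiples of a `p`-power-torsion element is cyclic -/

section Algebra

variable {H : Type*} [AddCommGroup H] {p : ℕ} [hp : Fact p.Prime]

/-- In the cyclic group `ℤ•β` generated by an element of `p`-power order, the `p`-torsion is cyclic: if `x = a•β ≠ 0`, `p•x = 0` and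
`y = b•β`, `p•y = 0`, then `y ∈ ℤ•x`. [folklore] -/
theorem exists_eq_zsmul_of_zsmul_of_prime_smul_eq_zero (β : H) {s : ℕ} (hβ : p ^ s • β = 0) {a b : ℤ} {x y : H}
    (hx : x = a • β) (hy : y = b • β) (hpx : p • x = 0) (hpy : p • y = 0) (hx0 : x ≠ 0) : ∃ m : ℤ, y = m • x := by
  -- the order of `β` is `p^t`
  have hord : addOrderOf β ∣ p ^ s := addOrderOf_dvd_of_nsmul_eq_zero hβ
  obtain ⟨t, -, ht⟩ := (Nat.dvd_prime_pow hp.out).mp hord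
  have hN : ∀ c : ℤ, c • β = 0 ↔ ((p : ℤ) ^ t) ∣ c := by
    intro c
    rw [← addOrderOf_dvd_iff_zsmul_eq_zero, ht]
    push_cast
    rfl
  -- `p^t ∣ p a`, `p^t ∤ a`; so `t ≥ 1`, `a = p^(t-1) a'` with `p ∤ a'`
  have hpa : ((p : ℤ) ^ t) ∣ p * a := by
    rw [← hN, mul_zsmul, ← hx, natCast_zsmul]; exact hpx
  have hna : ¬ ((p : ℤ) ^ t) ∣ a := by rw [← hN, ← hx]; exact hx0
  have ht1 : 1 ≤ t := by
    rcases Nat.eq_zero_or_pos t with h | h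
    · exact absurd (by rw [h, pow_zero]; exact one_dvd a) hna
    · exact h
  have hpp : Prime (p : ℤ) := Nat.prime_iff_prime_int.mp hp.out
  have hp0 : (p : ℤ) ≠ 0 := by exact_mod_cast hp.out.ne_zero
  -- `p^(t-1) ∣ a` and `p^(t-1) ∣ b`
  have hdiv : ∀ c : ℤ, ((p : ℤ) ^ t) ∣ p * c → ((p : ℤ) ^ (t - 1)) ∣ c := by
    intro c hc
    have : (p : ℤ) ^ t = p * (p : ℤ) ^ (t - 1) := by
      rw [← pow_succ', Nat.sub_add_cancel ht1]
    rw [this] at hc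
    exact (mul_dvd_mul_iff_left hp0).mp hc
  obtain ⟨a', ha'⟩ := hdiv a hpa
  have hpb : ((p : ℤ) ^ t) ∣ p * b := by
    rw [← hN, mul_zsmul, ← hy, natCast_zsmul]; exact hpy
  obtain ⟨b', hb'⟩ := hdiv b hpb
  -- `p ∤ a'`
  have hna' : ¬ (p : ℤ) ∣ a' := by
    rintro ⟨a'', rfl⟩
    apply hna
    refine ⟨a'', ?_⟩
    rw [ha', ← mul_assoc, ← pow_succ, Nat.sub_add_cancel ht1]
  -- solve `m a' ≡ b' (mod p)` in `ZMod p`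
  haveI : Fact (1 < p) := ⟨hp.out.one_lt⟩
  have ha'u : (a' : ZMod p) ≠ 0 := by
    rw [Ne, ZMod.intCast_zmod_eq_zero_iff_dvd]; exact hna'
  set m : ℤ := (((b' : ZMod p) * (a' : ZMod p)⁻¹).val : ℤ) with hm
  have hmab : (p : ℤ) ∣ m * a' - b' := by
    rw [← ZMod.intCast_zmod_eq_zero_iff_dvd]
    push_cast
    rw [hm, Int.cast_natCast, ZMod.natCast_zmod_val, mul_assoc, inv_mul_cancel₀ ha'u, mul_one, sub_self]
  refine ⟨m, ?_⟩
  -- `y - m x = (b - m a) • β = p^(t-1) (b' - m a') • β = 0`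
  rw [hx, hy, smul_smul, ← sub_eq_zero, ← sub_smul, hN]
  obtain ⟨q, hq⟩ := hmab
  refine ⟨-q, ?_⟩
  rw [ha', hb']
  have : (p : ℤ) ^ t = (p : ℤ) ^ (t - 1) * p := by rw [← pow_succ, Nat.sub_add_cancel ht1]
  rw [this]
  linear_combination (-(p : ℤ) ^ (t - 1)) * hq

/-- **A subgroup exhausted by a `p`-divisible tower of cyclic groups has cyclic `p`-torsion.** If every element of `L` is an integer multiple of
some `β n`, where the `β n` are `p`-power torsion and `β n = p^k • β (n+k)`, then any two `p`-torsion elements `x ≠ 0`, `y` of `L` satisfy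
`y ∈ ℤ•x`. [folklore] -/
theorem exists_eq_zsmul_of_tower (L : AddSubgroup H) (β : ℕ → H) (hβ : ∀ n, ∃ s : ℕ, p ^ s • β n = 0)
    (hcompat : ∀ n k : ℕ, β n = ((p : ℤ) ^ k) • β (n + k)) (hgen : ∀ x ∈ L, ∃ (n : ℕ) (M : ℤ), x = M • β n)
    {x y : H} (hxL : x ∈ L) (hyL : y ∈ L) (hpx : p • x = 0) (hpy : p • y = 0) (hx0 : x ≠ 0) : ∃ m : ℤ, y = m • x := by
  obtain ⟨n, M, hxM⟩ := hgen x hxL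
  obtain ⟨n', M', hyM⟩ := hgen y hyL
  obtain ⟨s, hs⟩ := hβ (n + n')
  refine exists_eq_zsmul_of_zsmul_of_prime_smul_eq_zero (β (n + n')) hs (a := M * (p : ℤ) ^ n') (b := M' * (p : ℤ) ^ n)
    ?_ ?_ hpx hpy hx0
  · rw [hxM, hcompat n n', smul_smul]
  · rw [hyM, hcompat n' n, smul_smul, Nat.add_comm n' n]

end Algebra

/-! ## §2. The local Kummer image at a rank-one place has cyclic `p`-torsion -/

section Kummer

variable {K : Type u} [Field K] [NumberField K] (V : WeierstrassCurve K) [V.IsElliptic] (p : ℕ) [Fact p.Prime]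
  (w : HeightOneSpectrum (𝓞 K))

/-- Global Kummer classes satisfy the classical local condition at every completion (`range κ = ker(H¹(K,E[p^∞]) → H¹(K,E))` lies in the
`p^∞`-Selmer group). [cite: GreenbergLNM1716, §2 p. 62] -/
theorem map_resSubgroup_range_kummer_le_localKerOver :
    ((V.kummerMapPInfty p V.zsmul_geomPoints_surjective_holds).range).map (resSubgroup ⊤ (V.geomPrimaryTorsion p)) ≤
      V.localKerOver p ⊤ (w.adicCompletion K) := by
  rintro _ ⟨x, hx, rfl⟩
  have hsel : x ∈ V.selmerGroupPInfty p := by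
    rw [V.range_kummerMapPInfty p] at hx
    exact V.ker_primaryH1ToH1_le_selmerGroupPInfty p hx
  simp only [WeierstrassCurve.selmerGroupPInfty, AddSubgroup.mem_inf, AddSubgroup.mem_iInf] at hsel
  exact V.resSubgroup_top_mem_localKerOver (hsel.1 w)

/-- **(T-loc) at a rank-one place.** If `E(K_w)/tors` is a line through the global point `P` (the rank-one relation `hrel`, supplied at the
dyadic places of the S3c frame by `LocalPointsScalar.exists_rankOne_rel_adicCompletion_two`), then the local image
`L_w := res_{D_w}(res_⊤(range κ))` of the global Kummer classes has CYCLIC `p`-torsion: for `x, y ∈ L_w` with `p x = p y = 0`, `x ≠ 0`,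
`y ∈ ℤ•x`. This is the hypothesis `hcyc` of -w3 g9's `comap_kummer_le_ker_resOfLe_of_finite_conj_of_cyclic` (p673070).
(Every element of `L_w` is `M • res κ_n(P)` by `exists_resOfLe_eq_zsmul_kummer_of_rankOne`, and `κ_n(P) = p^k • κ_{n+k}(P)`.)
[cite: Agboola2007, Prop. 6.11 (arXiv p0014)] [cite: GreenbergLNM1716, §2 Prop. 2.1] -/
theorem kummer_local_cyclic_of_rankOne (P : V.toAffine.Point)
    (hrel : ∀ y : localPoints V (w.adicCompletion K), (∀ σ : absoluteGaloisGroup (w.adicCompletion K), σ • y = y) →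
      ∃ a : ℕ, ∀ K' : ℕ, ∃ (M : ℤ) (y' : localPoints V (w.adicCompletion K)),
        (∀ σ : absoluteGaloisGroup (w.adicCompletion K), σ • y' = y') ∧
        IsOfFinAddOrder (((p : ℤ) ^ a) • y - M • pointsMap V (w.adicCompletion K) (toGeomPoints V P) - ((p : ℤ) ^ K') • y')) :
    ∀ x ∈ (((V.kummerMapPInfty p V.zsmul_geomPoints_surjective_holds).range).map (resSubgroup ⊤ (V.geomPrimaryTorsion p))).map
        (resOfLe (V.geomPrimaryTorsion p) (inf_le_left : ⊤ ⊓ decomp w ≤ ⊤)),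
      ∀ y ∈ (((V.kummerMapPInfty p V.zsmul_geomPoints_surjective_holds).range).map (resSubgroup ⊤ (V.geomPrimaryTorsion p))).map
        (resOfLe (V.geomPrimaryTorsion p) (inf_le_left : ⊤ ⊓ decomp w ≤ ⊤)),
      p • x = 0 → p • y = 0 → x ≠ 0 → ∃ m : ℤ, y = m • x := by
  set β : ℕ → subgroupH1 (⊤ ⊓ decomp w : Subgroup (absoluteGaloisGroup K)) (V.geomPrimaryTorsion p) := fun n ↦
    resOfLe (V.geomPrimaryTorsion p) (inf_le_left : ⊤ ⊓ decomp w ≤ ⊤)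
      (resSubgroup ⊤ (V.geomPrimaryTorsion p) (V.kummerMapLevel p V.zsmul_geomPoints_surjective_holds n P)) with hβdef
  have hβ : ∀ n, ∃ s : ℕ, p ^ s • β n = 0 := by
    intro n
    obtain ⟨J, hJ⟩ := exists_pow_smul_galH1Primary_eq_zero V p (V.kummerMapLevel p V.zsmul_geomPoints_surjective_holds n P)
    exact ⟨J, by rw [hβdef]; dsimp only; rw [← map_nsmul, ← map_nsmul, hJ, map_zero, map_zero]⟩
  have hcompat : ∀ n k : ℕ, β n = ((p : ℤ) ^ k) • β (n + k) := by
    intro n k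
    rw [hβdef]; dsimp only
    rw [← map_zsmul, ← map_zsmul, ← Nat.cast_pow, natCast_zsmul, ← map_nsmul,
      V.kummerMapLevel_level p V.zsmul_geomPoints_surjective_holds n k (n + k) rfl P]
  have hgen : ∀ x ∈ (((V.kummerMapPInfty p V.zsmul_geomPoints_surjective_holds).range).map
      (resSubgroup ⊤ (V.geomPrimaryTorsion p))).map (resOfLe (V.geomPrimaryTorsion p) (inf_le_left : ⊤ ⊓ decomp w ≤ ⊤)),
      ∃ (n : ℕ) (M : ℤ), x = M • β n := by
    intro x hx
    obtain ⟨c, hc, rfl⟩ := AddSubgroup.mem_map.mp hx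
    obtain ⟨M, n, hM⟩ := exists_resOfLe_eq_zsmul_kummer_of_rankOne V p w P hrel (map_resSubgroup_range_kummer_le_localKerOver V p w hc)
    exact ⟨n, M, hM⟩
  intro x hx y hy hpx hpy hx0
  exact exists_eq_zsmul_of_tower _ β hβ hcompat hgen hx hy hpx hpy hx0

/-- **(T-loc-cl) at a rank-one place**: the same for the local image `res_{D_w}(localKerOver p ⊤ K_w)` of ALL classes classical at `w`
(the hypothesis `hcl` of LEAD g12's cut 13 `restrictedControl_two_of_ptFacts_factor_values`, p674799): its `p`-torsion is cyclic.
(Every such class is `M • res κ_n(P)` on `D_w` by `exists_resOfLe_eq_zsmul_kummer_of_rankOne`.) [cite: Agboola2007, Prop. 6.11 (arXiv p0014)]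
[cite: GreenbergLNM1716, §2 Prop. 2.1] -/
theorem classical_local_cyclic_of_rankOne (P : V.toAffine.Point)
    (hrel : ∀ y : localPoints V (w.adicCompletion K), (∀ σ : absoluteGaloisGroup (w.adicCompletion K), σ • y = y) →
      ∃ a : ℕ, ∀ K' : ℕ, ∃ (M : ℤ) (y' : localPoints V (w.adicCompletion K)),
        (∀ σ : absoluteGaloisGroup (w.adicCompletion K), σ • y' = y') ∧
        IsOfFinAddOrder (((p : ℤ) ^ a) • y - M • pointsMap V (w.adicCompletion K) (toGeomPoints V P) - ((p : ℤ) ^ K') • y')) :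
    ∀ x ∈ (V.localKerOver p ⊤ (w.adicCompletion K)).map (resOfLe (V.geomPrimaryTorsion p) (inf_le_left : ⊤ ⊓ decomp w ≤ ⊤)),
      ∀ y ∈ (V.localKerOver p ⊤ (w.adicCompletion K)).map (resOfLe (V.geomPrimaryTorsion p) (inf_le_left : ⊤ ⊓ decomp w ≤ ⊤)),
      p • x = 0 → p • y = 0 → x ≠ 0 → ∃ m : ℤ, y = m • x := by
  set β : ℕ → subgroupH1 (⊤ ⊓ decomp w : Subgroup (absoluteGaloisGroup K)) (V.geomPrimaryTorsion p) := fun n ↦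
    resOfLe (V.geomPrimaryTorsion p) (inf_le_left : ⊤ ⊓ decomp w ≤ ⊤)
      (resSubgroup ⊤ (V.geomPrimaryTorsion p) (V.kummerMapLevel p V.zsmul_geomPoints_surjective_holds n P)) with hβdef
  have hβ : ∀ n, ∃ s : ℕ, p ^ s • β n = 0 := by
    intro n
    obtain ⟨J, hJ⟩ := exists_pow_smul_galH1Primary_eq_zero V p (V.kummerMapLevel p V.zsmul_geomPoints_surjective_holds n P)
    exact ⟨J, by rw [hβdef]; dsimp only; rw [← map_nsmul, ← map_nsmul, hJ, map_zero, map_zero]⟩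
  have hcompat : ∀ n k : ℕ, β n = ((p : ℤ) ^ k) • β (n + k) := by
    intro n k
    rw [hβdef]; dsimp only
    rw [← map_zsmul, ← map_zsmul, ← Nat.cast_pow, natCast_zsmul, ← map_nsmul,
      V.kummerMapLevel_level p V.zsmul_geomPoints_surjective_holds n k (n + k) rfl P]
  have hgen : ∀ x ∈ (V.localKerOver p ⊤ (w.adicCompletion K)).map
      (resOfLe (V.geomPrimaryTorsion p) (inf_le_left : ⊤ ⊓ decomp w ≤ ⊤)), ∃ (n : ℕ) (M : ℤ), x = M • β n := by
    intro x hx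
    obtain ⟨c, hc, rfl⟩ := AddSubgroup.mem_map.mp hx
    obtain ⟨M, n, hM⟩ := exists_resOfLe_eq_zsmul_kummer_of_rankOne V p w P hrel hc
    exact ⟨n, M, hM⟩
  intro x hx y hy hpx hpy hx0
  exact exists_eq_zsmul_of_tower _ β hβ hcompat hgen hx hy hpx hpy hx0

end Kummer

/-! ## §3. (T-loc) at both dyadic places of the S3c frame -/

section Frame

variable {K : Type} [Field K] [NumberField K] (V : WeierstrassCurve K) [V.IsElliptic]

/-- **(T-loc) ON THE FRAME**: `K` quadratic with two places `w ≠ w'` above `2`, `V/K` elliptic with a `K`-point `P_K` of infinite order: the local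
image at `w` of the global Kummer classes, `res_{D_w}(res_⊤(range κ)) ≤ H¹(⊤ ⊓ D_w, E[2^∞])`, has CYCLIC `2`-torsion — the hypothesis `hcyc` of
-w3 g9's `comap_kummer_le_ker_resOfLe_of_finite_conj_of_cyclic` (p673070), at `w = v` (and at `w = v̄`). Silverman VII.6.3 at `[K_w : ℚ₂] = 1`
(`exists_rankOne_rel_fixedPoints`) + `kummer_local_cyclic_of_rankOne`. [cite: SilvermanAEC2009, Prop. VII.6.3] [cite: Agboola2007, Prop. 6.11] -/
theorem kummer_local_cyclic_of_frame (hK2 : Module.finrank ℚ K = 2) {w w' : HeightOneSpectrum (𝓞 K)}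
    (hw : ((2 : ℕ) : 𝓞 K) ∈ w.asIdeal) (hw' : ((2 : ℕ) : 𝓞 K) ∈ w'.asIdeal) (hne : w' ≠ w)
    {PK : V.toAffine.Point} (hPK : ¬ IsOfFinAddOrder PK) :
    ∀ x ∈ (((V.kummerMapPInfty 2 V.zsmul_geomPoints_surjective_holds).range).map (resSubgroup ⊤ (V.geomPrimaryTorsion 2))).map
        (resOfLe (V.geomPrimaryTorsion 2) (inf_le_left : ⊤ ⊓ decomp w ≤ ⊤)),
      ∀ y ∈ (((V.kummerMapPInfty 2 V.zsmul_geomPoints_surjective_holds).range).map (resSubgroup ⊤ (V.geomPrimaryTorsion 2))).map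
        (resOfLe (V.geomPrimaryTorsion 2) (inf_le_left : ⊤ ⊓ decomp w ≤ ⊤)),
      2 • x = 0 → 2 • y = 0 → x ≠ 0 → ∃ m : ℤ, y = m • x :=
  kummer_local_cyclic_of_rankOne V 2 w PK (exists_rankOne_rel_fixedPoints V hK2 hw hw' hne hPK)

/-- **(T-loc-cl) ON THE FRAME**: as `kummer_local_cyclic_of_frame`, for the local image of ALL classical-at-`w` classes
`res_{D_w}(localKerOver 2 ⊤ K_w)` — the hypothesis `hcl` of LEAD g12's cut 13 at `w = v`. [cite: SilvermanAEC2009, Prop. VII.6.3]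
[cite: Agboola2007, Prop. 6.11] -/
theorem classical_local_cyclic_of_frame (hK2 : Module.finrank ℚ K = 2) {w w' : HeightOneSpectrum (𝓞 K)}
    (hw : ((2 : ℕ) : 𝓞 K) ∈ w.asIdeal) (hw' : ((2 : ℕ) : 𝓞 K) ∈ w'.asIdeal) (hne : w' ≠ w)
    {PK : V.toAffine.Point} (hPK : ¬ IsOfFinAddOrder PK) :
    ∀ x ∈ (V.localKerOver 2 ⊤ (w.adicCompletion K)).map (resOfLe (V.geomPrimaryTorsion 2) (inf_le_left : ⊤ ⊓ decomp w ≤ ⊤)),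
      ∀ y ∈ (V.localKerOver 2 ⊤ (w.adicCompletion K)).map (resOfLe (V.geomPrimaryTorsion 2) (inf_le_left : ⊤ ⊓ decomp w ≤ ⊤)),
      2 • x = 0 → 2 • y = 0 → x ≠ 0 → ∃ m : ℤ, y = m • x :=
  classical_local_cyclic_of_rankOne V 2 w PK (exists_rankOne_rel_fixedPoints V hK2 hw hw' hne hPK)

end Frame

/-! ## §4. (H2) of `rBV_of_three_factor_values`, VERBATIM and UNCONDITIONAL -/

section H2

open Summit.BirchSwinnertonDyer.BirchSwinnertonDyer.Theorems.PrintCf2.AdditiveAtSeven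

/-- **(H2) «`loc_{v̄}(𝔖_v ⊓ L_M) ⊆ loc_{v̄}(Q_M)`» — the `r = 1` EXHAUSTION AT `v̄` — HOLDS ON EVERY FRAME, unconditionally.** The displayed
hypothesis `hH2` of -w7 g2's `rBV_of_three_factor_values` (p665606) VERBATIM. Proof: for `c ∈ L_M` the class `ι_* c` is classical at `v̄`, so by the
local half (`exists_resOfLe_eq_zsmul_kummer_of_rankOne`, fed by the rank-one relation `exists_rankOne_rel_fixedPoints` at `v̄` through the
`ℚ`-generator `P`) `res_{D_v̄}(ι_* c) = M • res_{D_v̄}(res_⊤ κ_n(P_K))`; by the global half (`zsmul_proj_resSubgroup_kummer_mem_comap_kummer`)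
`c' := M • e_*(res_⊤ κ_n(P_K)) ∈ Q_M`; and `res_{D_v̄} c = e_*(res_{D_v̄} ι_* c) = res_{D_v̄} c'` (`e_* ι_* = id`, naturality). Most binders of the frame
(`[d]₂`, the pinning clause, `c₀`, `ℓ`, the rank, finiteness) are not used. [cite: Agboola2007, Prop. 6.11 (arXiv p0014:L60–80)]
[cite: GreenbergLNM1716, §2 Prop. 2.1 and p. 62] -/
theorem bottom_exhaustion_at_vbar : ∀ (d : ℤ), d ≠ 0 → Squarefree d → d % 4 ≠ 1 →
      ∀ (W : WeierstrassCurve ℚ) [W.IsElliptic] [W.IsGloballyMinimal] (C : VariableChange ℚ),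
        C • W = cm7.quadraticTwist (d : ℚ) → W.analyticRank = 1 →
      ∀ (K : Type) [Field K] [NumberField K], IsImaginaryQuadratic K →
      ∀ (v vbar : HeightOneSpectrum (𝓞 K)),
        ((2 : ℕ) : 𝓞 K) ∈ v.asIdeal → ((2 : ℕ) : 𝓞 K) ∈ vbar.asIdeal → vbar ≠ v →
      ∀ (π : (W.baseChange K).endRing), (π : AddMonoid.End (W.baseChange K).geomPoints) * π = π - 2 →
      ∀ (r : ℤ_[2]), r * r = r - 2 →
        (∀ τ ∈ GreenbergSelmer.inertia v, ∀ x : ↥((W.baseChange K).endEigenPrimaryTorsion 2 π r), τ • x = x ∨ τ • x = -x) →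
      ∀ (P : W.toAffine.Point) (c₀ : ℕ) (ℓ : ℤ),
        ¬ IsOfFinAddOrder P →
        (∀ R : W.toAffine.Point, ∃ (k : ℤ) (T : W.toAffine.Point), IsOfFinAddOrder T ∧ R = k • P + T) →
        c₀ ≠ 0 → (W.baseChange ℚ_[2]).IsInReductionKernel (c₀ • W.toPadicPoint 2 P) →
        ‖(W.baseChange ℚ_[2]).padicLogPoint (c₀ • W.toPadicPoint 2 P) / (c₀ : ℚ_[2])‖ = (2 : ℝ) ^ (-ℓ) →
      Finite (restrictedSelmerBase ↥((W.baseChange K).endEigenPrimaryTorsion 2 π r) 2 vbar) →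
        (restrictedSelmerBase ↥((W.baseChange K).endEigenPrimaryTorsion 2 π r) 2 v ⊓
            (((W.baseChange K).localKerOver 2 ⊤ (vbar.adicCompletion K)).comap
          (resH1Hom (ContinuousMonoidHom.id _) ((W.baseChange K).endEigenPrimaryTorsion 2 π r).subtype (fun _ _ ↦ rfl)))).map
            (resOfLe ↥((W.baseChange K).endEigenPrimaryTorsion 2 π r) (inf_le_left : ⊤ ⊓ decomp vbar ≤ ⊤)) ≤
          (((((W.baseChange K).kummerMapPInfty 2 (W.baseChange K).zsmul_geomPoints_surjective_holds).range).map
            (resSubgroup ⊤ ((W.baseChange K).geomPrimaryTorsion 2))).comap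
          (resH1Hom (ContinuousMonoidHom.id _) ((W.baseChange K).endEigenPrimaryTorsion 2 π r).subtype (fun _ _ ↦ rfl))).map
            (resOfLe ↥((W.baseChange K).endEigenPrimaryTorsion 2 π r) (inf_le_left : ⊤ ⊓ decomp vbar ≤ ⊤)) := by
  intro d hd0 _ _ W _ _ C hC _ K _ _ hK v vbar hv hvbar hne π hπ r hr _ P _ _ hP _ _ _ _ _
  obtain ⟨hinf, hsup⟩ := endEigenPrimaryTorsion_compl_of_frame hd0 W C hC K π hπ hr
  have hunit : IsUnit (r - (1 - r)) := (CMPrimes.two_dvd_or_two_dvd_one_sub_of_root hr).2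
  obtain ⟨e, he₁, -, hesub, he⟩ := exists_eigenProjector (W.baseChange K) 2 π r (1 - r) hinf hsup
  -- the `ℚ`-generator over `K`
  set PK : (W.baseChange K).toAffine.Point := WeierstrassCurve.Affine.Point.map (W' := W.toAffine) (S := ℚ) (Algebra.ofId ℚ K) P with hPKdef
  have hPK : ¬ IsOfFinAddOrder PK :=
    not_isOfFinAddOrder_map_of_injective _ (WeierstrassCurve.Affine.Point.map_injective (W' := W.toAffine) _) hP
  intro z hz
  obtain ⟨c, hc, rfl⟩ := AddSubgroup.mem_map.mp hz
  have hcL := (AddSubgroup.mem_inf.mp hc).2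
  rw [AddSubgroup.mem_comap] at hcL
  -- local half: `res_{D_v̄}(ι_* c) = M • res_{D_v̄}(res_⊤ κ_n(P_K))`
  obtain ⟨M, n, hM⟩ := exists_resOfLe_eq_zsmul_kummer_of_rankOne (W.baseChange K) 2 vbar PK
    (exists_rankOne_rel_fixedPoints (W.baseChange K) hK.1 hvbar hv hne.symm hPK) hcL
  -- global half: `c' := M • e_*(res_⊤ κ_n(P_K)) ∈ Q_M`
  set κn := resSubgroup (⊤ : Subgroup (absoluteGaloisGroup K)) ((W.baseChange K).geomPrimaryTorsion 2)
    ((W.baseChange K).kummerMapLevel 2 (W.baseChange K).zsmul_geomPoints_surjective_holds n PK) with hκn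
  have hκn' : (W.baseChange K).kummerMapLevel 2 (W.baseChange K).zsmul_geomPoints_surjective_holds n PK =
      (W.baseChange K).kummerMapPInfty 2 (W.baseChange K).zsmul_geomPoints_surjective_holds (PK ⊗ₜ prufGen 2 n) :=
    ((W.baseChange K).kummerMapPInfty_tmul_prufGen 2 (W.baseChange K).zsmul_geomPoints_surjective_holds PK n).symm
  set eκ : subgroupH1 (⊤ : Subgroup (absoluteGaloisGroup K)) ↥((W.baseChange K).endEigenPrimaryTorsion 2 π r) :=
    resH1Hom (ContinuousMonoidHom.id (⊤ : Subgroup (absoluteGaloisGroup K))) e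
      (fun σ x ↦ by rw [Subgroup.smul_def, Subgroup.smul_def]; exact he σ x) κn with heκ
  refine AddSubgroup.mem_map.mpr ⟨M • eκ, ?_, ?_⟩
  · have h := zsmul_proj_resSubgroup_kummer_mem_comap_kummer (W.baseChange K) 2 π r hinf hsup hunit e hesub he (PK ⊗ₜ prufGen 2 n) M
    rw [heκ, hκn, hκn']
    exact h
  · -- `res_{D_v̄}(M • e_* κn) = M • e_*(res_{D_v̄} κn) = e_*(res_{D_v̄} ι_* c) = res_{D_v̄} c`
    have hnat_e : ∀ x : subgroupH1 (⊤ : Subgroup (absoluteGaloisGroup K)) ((W.baseChange K).geomPrimaryTorsion 2),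
        resOfLe ↥((W.baseChange K).endEigenPrimaryTorsion 2 π r) (inf_le_left : ⊤ ⊓ decomp vbar ≤ ⊤)
            (resH1Hom (ContinuousMonoidHom.id (⊤ : Subgroup (absoluteGaloisGroup K))) e
              (fun σ x ↦ by rw [Subgroup.smul_def, Subgroup.smul_def]; exact he σ x) x) =
          resH1Hom (ContinuousMonoidHom.id (⊤ ⊓ decomp vbar : Subgroup (absoluteGaloisGroup K))) e (fun σ x ↦ he σ x)
            (resOfLe ((W.baseChange K).geomPrimaryTorsion 2) (inf_le_left : ⊤ ⊓ decomp vbar ≤ ⊤) x) := by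
      intro x
      have h := congrArg (fun f ↦ f x) (FineSelmerCoefficientMap.resOfLe_comp_resH1Hom_id
        (inf_le_left : (⊤ ⊓ decomp vbar : Subgroup (absoluteGaloisGroup K)) ≤ ⊤) e
        (fun σ x ↦ by rw [Subgroup.smul_def, Subgroup.smul_def]; exact he σ x) (fun σ x ↦ he σ x))
      simpa only [AddMonoidHom.comp_apply] using h
    have hid := congrArg (fun f ↦ f (resOfLe ↥((W.baseChange K).endEigenPrimaryTorsion 2 π r) (inf_le_left : ⊤ ⊓ decomp vbar ≤ ⊤) c))
      (resH1Hom_proj_comp_subtype (W.baseChange K) 2 π r (H := (⊤ ⊓ decomp vbar : Subgroup (absoluteGaloisGroup K))) e he₁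
        (fun σ x ↦ he σ x))
    simp only [AddMonoidHom.comp_apply, AddMonoidHom.id_apply] at hid
    rw [map_zsmul, heκ, hnat_e, ← map_zsmul, ← hM, resOfLe_resH1Hom_subtype (W.baseChange K) 2 π r, hid]

end H2

end Summit.BirchSwinnertonDyer.BirchSwinnertonDyer.Theorems.PrintCf2.RestrictedSelmerPair

end
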